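import Summits.QuantumFields.BalabanUV.Beta.CovariantTowerDecayCT

/-!
# Beta / CovariantTowerDecayTorus — an ADMISSIBLE RATE θ_k > 0 for the Combes–Thomas decay of the k-fold covariant tower
# operator Δ_U + Σ_{l≤k} a_l·G_lᵀG_l of the pv21 MODEL, and the TORUS instance: exponential decay of the inverse and of
# the Dirichlet inverse with EXPLICIT constants independent of the volume N and of the transport U
# (unit `b2b-balaban-beta-d4-p2`, GEN 4; third module of the chain `CovariantTowerDecay` → `CovariantTowerDecayCT` → this)

HONEST FRAMING: discharging `BetaPertH` makes Bałaban's UV stability UNCONDITIONAL — NOT the continuum limit, NOT the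
Clay problem.  HONEST DEPENDENCY (verbatim): «continuum YM on T⁴ ⇐ BetaPertH ∧ nine spine estimates (0/9 proved);
BetaPertH ⇐ (D1) ∧ (D4) ∧ CAP+tail; G-an2-4 gates asym, D1 and NE2/3/4.»  THIS MODULE DISCHARGES NOTHING of `BetaPertH`,
asserts NOTHING printed and cites nothing as a fact (ABSOLUTE RULE): [folklore] kernel theorems about the component MODEL
of the pv21 chain `Literature/…/Balaban1983to89/B9Thm37GlueTorusCov*` (model of [B9] = `Balaban1985BackgroundPropagators`,
T. Bałaban, *Propagators for lattice gauge theories in a background field*, Commun. Math. Phys. 99 (1985) 389–434,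
(3.15)/(3.16)/(3.19)/(3.23)–(3.24); SHAPE modelled: (3.42) entry 1, Thm 3.1 p. 397, and the Dirichlet G′ of p. 394).
Scope and honesty clauses: see the header of `CovariantTowerDecay`.

CONTENT.
* §1 `towerS_mono`, `ellTower`, `thetaTower`, `kappa_thetaTower_le`: the admissible rate
  θ_k = min(1/(2S_k + 1), σ/(2L_k + 1)) > 0, L_k = 2c_max²z + Σ_{l≤k} 4a_l·w_max²·S_l·N_l, satisfies κ_k(θ_k) ≤ σ/2
  (from e^x − 1 ≤ 2x on [0, 1] with x = θ_k and x = 2S_lθ_k ≤ 2S_kθ_k ≤ 1).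
* §2 the torus `UT N` with the cube-comb tower `torusTower` (sides M_j, 1 ≤ M_j, M_j ∣ N_i; z = d, D_j = d(M_j − 1),
  n_j = M_j^d): `entry_decay_tower_torus`, `dirInv_entry_decay_tower_torus`, `thetaTowerTorus`,
  `entry_decay_tower_torus_explicit` — |(Δ_U + Σ_l a_lG_lᵀG_l)⁻¹(p, p₀)| ≤ (2/σ_k)·e^{−θ_T·dist(p₀, p)} and the Dirichlet
  analogue with 2/min(σ_k, 1), σ_k = `sigmaTowerTorus d M a_min w_min c_min k`, θ_T = `thetaTowerTorus …` > 0 depending on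
  (d, M, k, a, c_min, c_max, w_min, w_max) only — for EVERY torus and EVERY isometric transport.

NOT ASSERTED: anything printed; ℓ²/entrywise norms, bond-step distance of `UT N`, crude constants.  Row D4: RECORDS value
(NODE A.4.0 entry 1, scalar side, at term level without an O.2 quantifier IN THE MODEL); class of (T3)/NODE O.2 unchanged;
D4 DISCHARGE NO DATE; NOT BetaPertH, NOT continuum, NOT Clay.
-/

namespace Summit.QuantumFields.BalabanUV.Beta.CovariantTowerDecayTorus

open Finset
open Literature.MathematicalPhysics.QuantumFieldTheory.Balaban1983to89
open B9Thm37Sum B9Thm37Glue B9Thm37GluePU B9Thm37GlueTorusInv B9Thm37GlueTorusCov B9Thm37GlueTorusCovComp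
open B9Thm37GlueTorusCovPoinc (tdepth_le card_block_le)
open B9Thm37GlueTorusCovLevels B9Thm37GlueTorusCovLevelsPoinc B9Thm37GlueTorusCovTower B9Thm37GlueTorusCovTowerDir
open B9Thm37GlueTorusCovCT (card_filter_bsrc_le card_filter_btgt_le abs_sub_dist_le)
open Summit.QuantumFields.BalabanUV.Beta.CovariantTowerDecay
open Summit.QuantumFields.BalabanUV.Beta.CovariantTowerDecayCT
open B5TorusCover (UT Ctr)

noncomputable section

/-! ## §1  An admissible rate θ_k -/

section Rate

/-- S is monotone in the level. [folklore] -/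
theorem towerS_mono (D : ℕ → ℕ) {l m : ℕ} (h : l ≤ m) : towerS D l ≤ towerS D m := by
  induction h with
  | refl => exact le_rfl
  | step _ ih => exact ih.trans (by rw [towerS_succ]; exact Nat.le_add_right _ _)

/-- MODEL bookkeeping: the linearised smallness constant L_k = 2c_max²z + Σ_{l≤k} 4a_l·w_max²·S_l·N_l. [folklore] -/
def ellTower (cmax wmax : ℝ) (z : ℕ) (D n : ℕ → ℕ) (k : ℕ) (a : Fin (k + 1) → ℝ) : ℝ :=
  2 * cmax ^ 2 * z + ∑ l : Fin (k + 1), 4 * a l * wmax ^ 2 * (towerS D l : ℝ) * (towerN n l : ℝ)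

/-- **An admissible decay rate for the tower**: θ_k = min(1/(2S_k + 1), σ/(2L_k + 1)) (MODEL bookkeeping). [folklore] -/
def thetaTower (σ cmax wmax : ℝ) (z : ℕ) (D n : ℕ → ℕ) (k : ℕ) (a : Fin (k + 1) → ℝ) : ℝ :=
  min (1 / (2 * (towerS D k : ℝ) + 1)) (σ / (2 * ellTower cmax wmax z D n k a + 1))

/-- L_k ≥ 0 for a_l ≥ 0. [folklore] -/
theorem ellTower_nonneg (cmax wmax : ℝ) (z : ℕ) (D n : ℕ → ℕ) (k : ℕ) {a : Fin (k + 1) → ℝ} (ha : ∀ l, 0 ≤ a l) :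
    0 ≤ ellTower cmax wmax z D n k a := by
  unfold ellTower
  refine add_nonneg (by positivity) (Finset.sum_nonneg fun l _ => ?_)
  have := ha l
  positivity

/-- θ_k > 0 (σ > 0, a_l ≥ 0). [folklore] -/
theorem thetaTower_pos {σ : ℝ} (hσ : 0 < σ) (cmax wmax : ℝ) (z : ℕ) (D n : ℕ → ℕ) (k : ℕ)
    {a : Fin (k + 1) → ℝ} (ha : ∀ l, 0 ≤ a l) : 0 < thetaTower σ cmax wmax z D n k a := by
  unfold thetaTower
  refine lt_min (by positivity) (div_pos hσ ?_)
  linarith [ellTower_nonneg cmax wmax z D n k ha]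

/-- **θ_k is admissible**: κ_k(θ_k) ≤ σ/2 (σ > 0, a_l ≥ 0) — from e^x − 1 ≤ 2x on [0, 1], applied with x = θ_k ≤ 1 and
x = 2S_lθ_k ≤ 2S_kθ_k ≤ 1. [folklore] -/
theorem kappa_thetaTower_le {σ : ℝ} (hσ : 0 < σ) (cmax wmax : ℝ) (z : ℕ) (D n : ℕ → ℕ) (k : ℕ)
    {a : Fin (k + 1) → ℝ} (ha : ∀ l, 0 ≤ a l) :
    kappaTower (thetaTower σ cmax wmax z D n k a) cmax wmax z D n k a ≤ σ / 2 := by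
  set θ := thetaTower σ cmax wmax z D n k a with hθdef
  set L := ellTower cmax wmax z D n k a with hL
  have hL0 : 0 ≤ L := ellTower_nonneg cmax wmax z D n k ha
  have hθ0 : 0 < θ := thetaTower_pos hσ cmax wmax z D n k ha
  have hθ1 : θ ≤ 1 / (2 * (towerS D k : ℝ) + 1) := min_le_left _ _
  have hθ2 : θ ≤ σ / (2 * L + 1) := min_le_right _ _
  have hS0 : (0 : ℝ) ≤ towerS D k := Nat.cast_nonneg _
  have hS1 : 0 < 2 * (towerS D k : ℝ) + 1 := by linarith
  have hθS : θ * (2 * towerS D k + 1) ≤ 1 := by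
    have := (le_div_iff₀ hS1).mp hθ1
    linarith
  have hle1 : θ ≤ 1 := by nlinarith
  have hexp : ∀ x : ℝ, 0 ≤ x → x ≤ 1 → Real.exp x - 1 ≤ 2 * x := fun x h0 h1 => by
    have h := Real.abs_exp_sub_one_le (x := x) (by rw [abs_of_nonneg h0]; exact h1)
    rw [abs_of_nonneg h0] at h
    exact (le_abs_self _).trans h
  have he1 : Real.exp θ - 1 ≤ 2 * θ := hexp θ hθ0.le hle1
  have he2 : ∀ l : Fin (k + 1), Real.exp (2 * (towerS D l : ℝ) * θ) - 1 ≤ 2 * (2 * (towerS D l : ℝ) * θ) := by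
    intro l
    have hlk : (towerS D l : ℝ) ≤ towerS D k := by
      exact_mod_cast towerS_mono D (Nat.lt_succ_iff.mp l.isLt)
    have h0 : 0 ≤ 2 * (towerS D l : ℝ) * θ := by positivity
    have h1 : 2 * (towerS D l : ℝ) * θ ≤ 1 := by nlinarith
    exact hexp _ h0 h1
  have hκ : kappaTower θ cmax wmax z D n k a ≤ θ * L := by
    unfold kappaTower
    have t1 : cmax ^ 2 * (Real.exp θ - 1) * z ≤ cmax ^ 2 * (2 * θ) * z :=
      mul_le_mul_of_nonneg_right (mul_le_mul_of_nonneg_left he1 (sq_nonneg _)) (Nat.cast_nonneg _)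
    have t2 : ∀ l : Fin (k + 1), a l * (wmax ^ 2 * (Real.exp (2 * (towerS D l : ℝ) * θ) - 1) * (towerN n l : ℝ)) ≤
        a l * (wmax ^ 2 * (2 * (2 * (towerS D l : ℝ) * θ)) * (towerN n l : ℝ)) := fun l =>
      mul_le_mul_of_nonneg_left
        (mul_le_mul_of_nonneg_right (mul_le_mul_of_nonneg_left (he2 l) (sq_nonneg _)) (Nat.cast_nonneg _)) (ha l)
    calc _ ≤ cmax ^ 2 * (2 * θ) * z +
          ∑ l : Fin (k + 1), a l * (wmax ^ 2 * (2 * (2 * (towerS D l : ℝ) * θ)) * (towerN n l : ℝ)) :=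
          add_le_add t1 (Finset.sum_le_sum fun l _ => t2 l)
      _ = θ * L := by
          rw [hL, ellTower, mul_add, Finset.mul_sum]
          congr 1
          · ring
          · exact Finset.sum_congr rfl fun l _ => by ring
  have hL1 : 0 < 2 * L + 1 := by linarith
  have hθL : θ * (2 * L + 1) ≤ σ := (le_div_iff₀ hL1).mp hθ2
  nlinarith

end Rate

/-! ## §2  The torus: decay of the tower inverse and of its Dirichlet inverse, uniform in the volume and in U -/

section Torus

variable {d : ℕ} {N : Fin d → ℕ} [∀ i, NeZero (N i)] [NeZero d]

/-- **COMBES–THOMAS DECAY OF THE TOWER INVERSE ON THE TORUS, UNIFORM IN THE VOLUME AND IN THE TRANSPORT (MODEL of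
(3.42) entry 1 for the k-fold averaged Δ_U + Σ_{l≤k} a_l·G_lᵀG_l).**  Torus `UT N`, cube combs of sides M_j (1 ≤ M_j,
M_j ∣ N_i), every isometric transport, c_min ≤ |c| ≤ c_max, block weights w_min ≤ |w_l| (on the cover) and |w_l| ≤ w_max,
a_l ≥ 0 with the cover as in `coercive_towerOp_torus`, and every θ ≥ 0 with
κ_k(θ) (z = d, D_j = d(M_j − 1), n_j = M_j^d) ≤ σ_k/2, σ_k = `sigmaTowerTorus d M a_min w_min c_min k`:
|(…)⁻¹(p, p₀)| ≤ (2/σ_k)·e^{−θ·dist(p₀, p)}. [folklore] -/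
theorem entry_decay_tower_torus {Cp : Type} [Fintype Cp] [DecidableEq Cp] {M : ℕ → ℕ} (hM : ∀ j, 1 ≤ M j)
    (hdiv : ∀ j i, M j ∣ N i) (c : UT N × Fin d → ℝ) {cmin cmax : ℝ} (hcmin : 0 < cmin) (hc : ∀ b, cmin ≤ |c b|)
    (hc' : ∀ b, |c b| ≤ cmax) (Rm : UT N × Fin d → Cp → Cp → ℝ)
    (hRm : ∀ b i j, ∑ k, Rm b k i * Rm b k j = if i = j then (1 : ℝ) else 0) (k : ℕ)
    (w : Fin (k + 1) → UT N → ℝ) {wmax : ℝ} (hw' : ∀ l y, |w l y| ≤ wmax) {a : Fin (k + 1) → ℝ} (ha : ∀ l, 0 ≤ a l)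
    {amin wmin : ℝ} (hamin : 0 < amin) (hwmin : 0 < wmin)
    (hcov : ∀ x, ∃ l : Fin (k + 1), amin ≤ a l ∧ wmin ≤ |w l (towerBlk (torusTower hM hdiv) (l : ℕ) x)|)
    {θ : ℝ} (hθ : 0 ≤ θ)
    (hκ : kappaTower θ cmax wmax d (fun j => d * (M j - 1)) (fun j => M j ^ d) k a ≤
      sigmaTowerTorus d M amin wmin cmin k / 2) (p₀ p : UT N × Cp) :
    |Ring.inverse (towerOp (torusTower hM hdiv) Rm c k
        (fun l x => w l (towerBlk (torusTower hM hdiv) (l : ℕ) x)) a) (Pi.single p₀ 1) p| ≤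
      2 / sigmaTowerTorus d M amin wmin cmin k * Real.exp (-(θ * dist p₀.1 p.1)) := by
  have h := entry_le_tower (torusTower hM hdiv) Rm hRm hcmin hc hc' (fun j x => tdepth_le (hM j) x)
    (fun j z => card_block_le (hM j) (hdiv j) z) k w hw' ha hamin hwmin hcov hθ (fun x => θ * dist p₀.1 x)
    (fun b => abs_sub_dist_le p₀.1 hθ b) card_filter_bsrc_le card_filter_btgt_le hκ p₀ p
  simpa [dist_self, sigmaTowerTorus] using h

/-- **… and of the DIRICHLET inverse G′ on a torus region Ω₀ = {χ = 1}** (cover on Ω₀ only; constant 2/min(σ_k, 1);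
smallness κ_k(θ) ≤ min(σ_k, 1)/2). [folklore] -/
theorem dirInv_entry_decay_tower_torus {Cp : Type} [Fintype Cp] [DecidableEq Cp] {M : ℕ → ℕ} (hM : ∀ j, 1 ≤ M j)
    (hdiv : ∀ j i, M j ∣ N i) (c : UT N × Fin d → ℝ) {cmin cmax : ℝ} (hcmin : 0 < cmin) (hc : ∀ b, cmin ≤ |c b|)
    (hc' : ∀ b, |c b| ≤ cmax) (Rm : UT N × Fin d → Cp → Cp → ℝ)
    (hRm : ∀ b i j, ∑ k, Rm b k i * Rm b k j = if i = j then (1 : ℝ) else 0) (k : ℕ)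
    (w : Fin (k + 1) → UT N → ℝ) {wmax : ℝ} (hw' : ∀ l y, |w l y| ≤ wmax) {a : Fin (k + 1) → ℝ} (ha : ∀ l, 0 ≤ a l)
    {amin wmin : ℝ} (hamin : 0 < amin) (hwmin : 0 < wmin) {χ : UT N × Cp → ℝ} (hχ : ∀ p, χ p = 0 ∨ χ p = 1)
    (hcov : ∀ x i, χ (x, i) = 1 →
      ∃ l : Fin (k + 1), amin ≤ a l ∧ wmin ≤ |w l (towerBlk (torusTower hM hdiv) (l : ℕ) x)|)
    {θ : ℝ} (hθ : 0 ≤ θ)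
    (hκ : kappaTower θ cmax wmax d (fun j => d * (M j - 1)) (fun j => M j ^ d) k a ≤
      min (sigmaTowerTorus d M amin wmin cmin k) 1 / 2) (p₀ p : UT N × Cp) :
    |dirInv (towerOp (torusTower hM hdiv) Rm c k
        (fun l x => w l (towerBlk (torusTower hM hdiv) (l : ℕ) x)) a) χ (Pi.single p₀ 1) p| ≤
      2 / min (sigmaTowerTorus d M amin wmin cmin k) 1 * Real.exp (-(θ * dist p₀.1 p.1)) := by
  have h := dirInv_entry_le_tower (torusTower hM hdiv) Rm hRm hcmin hc hc' (fun j x => tdepth_le (hM j) x)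
    (fun j z => card_block_le (hM j) (hdiv j) z) k w hw' ha hamin hwmin hχ hcov hθ (fun x => θ * dist p₀.1 x)
    (fun b => abs_sub_dist_le p₀.1 hθ b) card_filter_bsrc_le card_filter_btgt_le hκ p₀ p
  simpa [dist_self, sigmaTowerTorus] using h

/-- MODEL bookkeeping: **the admissible decay rate of the torus tower**, θ_T = `thetaTower σ c_max w_max d (j ↦ d(M_j−1))
(j ↦ M_j^d) k a` — for σ = σ_k (inverse) or σ = min(σ_k, 1) (Dirichlet inverse); independent of N and U. [folklore] -/
def thetaTowerTorus (d : ℕ) (M : ℕ → ℕ) (σ cmax wmax : ℝ) (k : ℕ) (a : Fin (k + 1) → ℝ) : ℝ :=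
  thetaTower σ cmax wmax d (fun j => d * (M j - 1)) (fun j => M j ^ d) k a

/-- **EXPONENTIAL DECAY OF THE k-FOLD TOWER INVERSE ON EVERY TORUS WITH EXPLICIT N- AND U-INDEPENDENT CONSTANTS (MODEL
of (3.42) entry 1).**  |(Δ_U + Σ_{l≤k} a_l·G_lᵀG_l)⁻¹(p, p₀)| ≤ (2/σ_k)·e^{−θ_T·dist(p₀, p)} with σ_k = `sigmaTowerTorus d M
a_min w_min c_min k` and θ_T = `thetaTowerTorus d M σ_k c_max w_max k a` > 0, for every torus `UT N` (M_j ∣ N_i), every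
isometric transport and all weights in the stated ranges. [folklore] -/
theorem entry_decay_tower_torus_explicit {Cp : Type} [Fintype Cp] [DecidableEq Cp] {M : ℕ → ℕ} (hM : ∀ j, 1 ≤ M j)
    (hdiv : ∀ j i, M j ∣ N i) (c : UT N × Fin d → ℝ) {cmin cmax : ℝ} (hcmin : 0 < cmin) (hc : ∀ b, cmin ≤ |c b|)
    (hc' : ∀ b, |c b| ≤ cmax) (Rm : UT N × Fin d → Cp → Cp → ℝ)
    (hRm : ∀ b i j, ∑ k, Rm b k i * Rm b k j = if i = j then (1 : ℝ) else 0) (k : ℕ)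
    (w : Fin (k + 1) → UT N → ℝ) {wmax : ℝ} (hw' : ∀ l y, |w l y| ≤ wmax) {a : Fin (k + 1) → ℝ} (ha : ∀ l, 0 ≤ a l)
    {amin wmin : ℝ} (hamin : 0 < amin) (hwmin : 0 < wmin)
    (hcov : ∀ x, ∃ l : Fin (k + 1), amin ≤ a l ∧ wmin ≤ |w l (towerBlk (torusTower hM hdiv) (l : ℕ) x)|)
    (p₀ p : UT N × Cp) :
    |Ring.inverse (towerOp (torusTower hM hdiv) Rm c k
        (fun l x => w l (towerBlk (torusTower hM hdiv) (l : ℕ) x)) a) (Pi.single p₀ 1) p| ≤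
      2 / sigmaTowerTorus d M amin wmin cmin k *
        Real.exp (-(thetaTowerTorus d M (sigmaTowerTorus d M amin wmin cmin k) cmax wmax k a * dist p₀.1 p.1)) :=
  entry_decay_tower_torus hM hdiv c hcmin hc hc' Rm hRm k w hw' ha hamin hwmin hcov
    (thetaTower_pos (sigmaTowerTorus_pos d M cmin k hamin hwmin) cmax wmax d _ _ k ha).le
    (kappa_thetaTower_le (sigmaTowerTorus_pos d M cmin k hamin hwmin) cmax wmax d _ _ k ha)
    p₀ p

end Torus

end

end Summit.QuantumFields.BalabanUV.Beta.CovariantTowerDecayTorus
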